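import Mathlib.Analysis.SpecialFunctions.Integrals.Basic
import Mathlib.Analysis.SpecialFunctions.Sqrt
import Mathlib.Data.Matrix.Mul
import Mathlib.LinearAlgebra.Matrix.Notation
import Mathlib.Tactic.FinCases
import Literature.MathematicalPhysics.QuantumLattice.LadderBandIdentities

/-!
# Two-level hybridisation and the anion-ordering zone folding of a quasi-1D band

Exact one-body statements behind the "transverse `(0, π/b)` modulation" model of the ClO₄
anion ordering in (TMTSF)₂ClO₄ [MontambauxJerome2016, §3]; every declaration is a definition
with a body or a proved theorem, there are no named facts.

## 1. The general real symmetric two-level problem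
For `hybBloch ε₁ ε₂ Δ = !![ε₁, Δ; Δ, ε₂]` write `m = (ε₁ + ε₂)/2` (`hybMean`),
`d = (ε₁ − ε₂)/2` (`hybHalfDiff`) and `R = √(d² + Δ²)` (`hybRadius`).  Proved:
the characteristic polynomial factorises as `(x − ε₁)(x − ε₂) − Δ² = (x − (m+R))(x − (m−R))`
(`hyb_charpoly_factor`), so its roots are exactly `m ± R` (`hyb_charpoly_root_iff`);
explicit eigenvectors `(d ± R, Δ)` and `(Δ, R − d)`, `(Δ, −(R + d))`
(`hybBloch_mulVec_upper/lower` and primed forms); `trace`/`det` identities; the level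
SPLITTING `(m + R) − (m − R) = 2R` obeys `2|Δ| ≤ 2R` (`hyb_splitting_ge`, "level repulsion":
the gap is at least twice the coupling), with equality iff the bare levels are degenerate
(`hybRadius_eq_abs_coupling_iff`), and `2|d| ≤ 2R`; uncoupled case `Δ = 0 ⇒ R = |d|`, i.e. the
bare levels `max/min (ε₁, ε₂)` (`hybUpper_of_coupling_zero` …); equal-diagonal case
`hybBloch a a c = ladderBloch a c` of `LadderBandIdentities` (`hybBloch_eq_ladderBloch`).

## 2. The anion-ordering instance [MontambauxJerome2016, §3]
With the linearised two-harmonic band `ε_k = ħv_F(|k_x| − k_F) − 2t_b cos k_y b` (their (1),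
`t′_b = 0`) and `Q⊥ = (0, π/b)`, the AO potential `Δ⊥` couples `ε_k = ξ − c` and
`ε_{k−Q⊥} = ξ + c`, `ξ = ħv_F(k_x − k_F)`, `c = 2t_b cos k_y b` (`aoBloch`).  Proved: the two
folded bands are `E± = ξ ± √(Δ⊥² + 4t_b² cos² k_y b)` (`ao_band_upper/lower`,
`aoBloch_mulVec_upper/lower` — their displayed spectrum); the splitting
`2√(Δ⊥² + 4t_b² cos² k_y b)` lies between `2|Δ⊥|` (attained at `k_y b = π/2`, the zone
boundary of the folded zone: `ao_splitting_zone_boundary`) and `2√(Δ⊥² + 4t_b²)`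
(`ao_splitting_le`); the Fermi surface `E± = 0` is `k_x = k_F ∓ √(…)/ħv_F`
(`ao_fermi_upper/lower_iff` — "two warped sheets along the same side", four in all), the two
sheets being `2√(…)/ħv_F ≥ 2|Δ⊥|/ħv_F` apart (`ao_sheetSeparation_ge`); QUENCHED twin
`Δ⊥ = 0`: the bands are the bare `ξ ± |c|` and the sheets touch at `k_y b = π/2`
(`ao_band_upper_quenched`, `ao_splitting_quenched_zone_boundary`).

## 3. Magnetic breakdown and the rapid-oscillation field [MontambauxJerome2016, §3]
`aoBreakdownField Δ e t_b b v_F = (π/2)·Δ²/(e t_b b v_F)` (their `B⊥`; quadratic in `Δ`,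
zero for the quenched twin), Landau–Zener probability `lzProbability B⊥ B = exp(−B⊥/B)`
(in `(0, 1]`, `= 1` iff `B⊥ = 0`, `= 1/2` iff `B = B⊥/log 2` — their `B_m`), the Stark
amplitude factor `2p(1 − p) ≤ 1/2` with equality iff `p = 1/2` (`stark_factor_le_half`), and
`fPerp x = ∫₀^{π/2} √(cos² t + x²) dt` with `fPerp 0 = 1` (`fPerp_zero`), `fPerp` monotone on
`0 ≤ x` (`fPerp_mono`) and `(π/2)|x| ≤ fPerp x ≤ (π/2)√(1 + x²)` (`fPerp_bounds`); hence the
rapid-oscillation field `roField t_b e v_F b Δ = (4t_b/(π e v_F b))·fPerp(Δ/2t_b)` equals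
`4t_b/(π e v_F b)` at `Δ = 0` and increases with `Δ` (`roField_zero`, `roField_mono`).

Not here: which numbers (the paper's `t_a ≈ 3000 K`, `t_b ≈ 300 K`, `Δ⊥ ≈ 14 meV ⇒ B⊥ ≈ 40 T`
are data, kept in the cell's REFVALS file), the Landau–Zener derivation itself, the Stokes
phase, anything approximate.

References: G. Montambaux, D. Jérome, "Rapid magnetic oscillations and magnetic breakdown in
quasi-1D conductors", C. R. Physique 17 (2016) 376–388, arXiv:1507.00037, §§2–3.  AI-produced
formalisation (H21, cell hubbard-downfold, seat lit-2, 2026-08-27); no facts, no axioms beyond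
Mathlib's, no `sorry`.
-/

namespace Literature.MathematicalPhysics.QuantumLattice

open Real Matrix

/-! ### 1. General two-level hybridisation -/

/-- The real symmetric two-level Bloch matrix `!![ε₁, Δ; Δ, ε₂]` (bare levels `ε₁, ε₂`,
coupling `Δ`). [cite: MontambauxJerome2016, §3 Eq. for H_A] -/
def hybBloch (ε₁ ε₂ Δ : ℝ) : Matrix (Fin 2) (Fin 2) ℝ := !![ε₁, Δ; Δ, ε₂]

/-- Unfolding of `hybBloch`. [cite: MontambauxJerome2016, §3] -/
theorem hybBloch_def (ε₁ ε₂ Δ : ℝ) : hybBloch ε₁ ε₂ Δ = !![ε₁, Δ; Δ, ε₂] := rfl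

/-- Equal bare levels: the two-level matrix is the ladder Bloch matrix of
`LadderBandIdentities`. [cite: MontambauxJerome2016, §3] -/
theorem hybBloch_eq_ladderBloch (a c : ℝ) : hybBloch a a c = ladderBloch a c := rfl

/-- Mean bare level `m = (ε₁ + ε₂)/2`. [cite: MontambauxJerome2016, §3] -/
noncomputable def hybMean (ε₁ ε₂ : ℝ) : ℝ := (ε₁ + ε₂) / 2

/-- Half the bare-level difference `d = (ε₁ − ε₂)/2`. [cite: MontambauxJerome2016, §3] -/
noncomputable def hybHalfDiff (ε₁ ε₂ : ℝ) : ℝ := (ε₁ - ε₂) / 2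

/-- The hybridisation radius `R = √(d² + Δ²)`, half the level splitting.
[cite: MontambauxJerome2016, §3] -/
noncomputable def hybRadius (ε₁ ε₂ Δ : ℝ) : ℝ := Real.sqrt (hybHalfDiff ε₁ ε₂ ^ 2 + Δ ^ 2)

/-- Upper hybridised level `m + R`. [cite: MontambauxJerome2016, §3] -/
noncomputable def hybUpper (ε₁ ε₂ Δ : ℝ) : ℝ := hybMean ε₁ ε₂ + hybRadius ε₁ ε₂ Δ

/-- Lower hybridised level `m − R`. [cite: MontambauxJerome2016, §3] -/
noncomputable def hybLower (ε₁ ε₂ Δ : ℝ) : ℝ := hybMean ε₁ ε₂ - hybRadius ε₁ ε₂ Δ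

/-- Unfolding of `hybMean`. [cite: MontambauxJerome2016, §3] -/
theorem hybMean_def (ε₁ ε₂ : ℝ) : hybMean ε₁ ε₂ = (ε₁ + ε₂) / 2 := rfl
/-- Unfolding of `hybHalfDiff`. [cite: MontambauxJerome2016, §3] -/
theorem hybHalfDiff_def (ε₁ ε₂ : ℝ) : hybHalfDiff ε₁ ε₂ = (ε₁ - ε₂) / 2 := rfl
/-- Unfolding of `hybRadius`: `R = √(((ε₁ − ε₂)/2)² + Δ²)`. [cite: MontambauxJerome2016, §3] -/
theorem hybRadius_def (ε₁ ε₂ Δ : ℝ) :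
    hybRadius ε₁ ε₂ Δ = Real.sqrt (((ε₁ - ε₂) / 2) ^ 2 + Δ ^ 2) := rfl
/-- Unfolding of the upper level `m + R`. [cite: MontambauxJerome2016, §3] -/
theorem hybUpper_def (ε₁ ε₂ Δ : ℝ) :
    hybUpper ε₁ ε₂ Δ = (ε₁ + ε₂) / 2 + Real.sqrt (((ε₁ - ε₂) / 2) ^ 2 + Δ ^ 2) := rfl
/-- Unfolding of the lower level `m − R`. [cite: MontambauxJerome2016, §3] -/
theorem hybLower_def (ε₁ ε₂ Δ : ℝ) :
    hybLower ε₁ ε₂ Δ = (ε₁ + ε₂) / 2 - Real.sqrt (((ε₁ - ε₂) / 2) ^ 2 + Δ ^ 2) := rfl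

/-- `0 ≤ R`. [cite: MontambauxJerome2016, §3] -/
theorem hybRadius_nonneg (ε₁ ε₂ Δ : ℝ) : 0 ≤ hybRadius ε₁ ε₂ Δ := Real.sqrt_nonneg _

/-- `R² = d² + Δ²`. [cite: MontambauxJerome2016, §3] -/
theorem hybRadius_sq (ε₁ ε₂ Δ : ℝ) :
    hybRadius ε₁ ε₂ Δ ^ 2 = hybHalfDiff ε₁ ε₂ ^ 2 + Δ ^ 2 :=
  Real.sq_sqrt (by positivity)

/-- Level repulsion: `|Δ| ≤ R`. [cite: MontambauxJerome2016, §3] -/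
theorem abs_coupling_le_hybRadius (ε₁ ε₂ Δ : ℝ) : |Δ| ≤ hybRadius ε₁ ε₂ Δ := by
  rw [← Real.sqrt_sq_eq_abs]
  exact Real.sqrt_le_sqrt (by nlinarith [sq_nonneg (hybHalfDiff ε₁ ε₂)])

/-- `|d| ≤ R`. [cite: MontambauxJerome2016, §3] -/
theorem abs_halfDiff_le_hybRadius (ε₁ ε₂ Δ : ℝ) : |hybHalfDiff ε₁ ε₂| ≤ hybRadius ε₁ ε₂ Δ := by
  rw [← Real.sqrt_sq_eq_abs]
  exact Real.sqrt_le_sqrt (by nlinarith [sq_nonneg Δ])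

/-- The splitting of the two hybridised levels is `2R`. [cite: MontambauxJerome2016, §3] -/
theorem hyb_splitting (ε₁ ε₂ Δ : ℝ) :
    hybUpper ε₁ ε₂ Δ - hybLower ε₁ ε₂ Δ = 2 * hybRadius ε₁ ε₂ Δ := by
  unfold hybUpper hybLower; ring

/-- The splitting is at least twice the coupling. [cite: MontambauxJerome2016, §3] -/
theorem hyb_splitting_ge (ε₁ ε₂ Δ : ℝ) :
    2 * |Δ| ≤ hybUpper ε₁ ε₂ Δ - hybLower ε₁ ε₂ Δ := by
  rw [hyb_splitting]; linarith [abs_coupling_le_hybRadius ε₁ ε₂ Δ]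

/-- The splitting is at least the bare splitting `|ε₁ − ε₂|`. [cite: MontambauxJerome2016, §3] -/
theorem hyb_splitting_ge_bare (ε₁ ε₂ Δ : ℝ) :
    |ε₁ - ε₂| ≤ hybUpper ε₁ ε₂ Δ - hybLower ε₁ ε₂ Δ := by
  rw [hyb_splitting]
  have h := abs_halfDiff_le_hybRadius ε₁ ε₂ Δ
  rw [hybHalfDiff, abs_div, abs_two] at h
  linarith

/-- `m − R ≤ m + R`. [cite: MontambauxJerome2016, §3] -/
theorem hybLower_le_hybUpper (ε₁ ε₂ Δ : ℝ) : hybLower ε₁ ε₂ Δ ≤ hybUpper ε₁ ε₂ Δ := by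
  linarith [hyb_splitting ε₁ ε₂ Δ, hybRadius_nonneg ε₁ ε₂ Δ]

/-- Degenerate bare levels: `R = |Δ|` (the minimum splitting `2|Δ|` is attained).
[cite: MontambauxJerome2016, §3] -/
theorem hybRadius_of_levels_eq (ε Δ : ℝ) : hybRadius ε ε Δ = |Δ| := by
  rw [hybRadius, hybHalfDiff, sub_self, zero_div, sq, zero_mul, zero_add, Real.sqrt_sq_eq_abs]

/-- `R = |Δ|` iff the bare levels are degenerate. [cite: MontambauxJerome2016, §3] -/
theorem hybRadius_eq_abs_coupling_iff (ε₁ ε₂ Δ : ℝ) :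
    hybRadius ε₁ ε₂ Δ = |Δ| ↔ ε₁ = ε₂ := by
  constructor
  · intro h
    have h2 := hybRadius_sq ε₁ ε₂ Δ
    rw [h, sq_abs] at h2
    have hd : hybHalfDiff ε₁ ε₂ ^ 2 = 0 := by linarith
    have hd' : hybHalfDiff ε₁ ε₂ = 0 := by
      rcases sq_eq_zero_iff.mp hd with h'
      exact h'
    unfold hybHalfDiff at hd'
    linarith
  · rintro rfl; exact hybRadius_of_levels_eq ε₁ Δ

/-- Uncoupled levels: `R = |d|`. [cite: MontambauxJerome2016, §3] -/
theorem hybRadius_of_coupling_zero (ε₁ ε₂ : ℝ) :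
    hybRadius ε₁ ε₂ 0 = |hybHalfDiff ε₁ ε₂| := by
  rw [hybRadius, sq (0:ℝ), zero_mul, add_zero, Real.sqrt_sq_eq_abs]

/-- Uncoupled levels: the upper level is `max ε₁ ε₂`. [cite: MontambauxJerome2016, §3] -/
theorem hybUpper_of_coupling_zero (ε₁ ε₂ : ℝ) : hybUpper ε₁ ε₂ 0 = max ε₁ ε₂ := by
  rw [hybUpper, hybRadius_of_coupling_zero, hybMean, hybHalfDiff]
  rcases le_total ε₁ ε₂ with h | h
  · rw [max_eq_right h, abs_of_nonpos (by linarith)]; ring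
  · rw [max_eq_left h, abs_of_nonneg (by linarith)]; ring

/-- Uncoupled levels: the lower level is `min ε₁ ε₂`. [cite: MontambauxJerome2016, §3] -/
theorem hybLower_of_coupling_zero (ε₁ ε₂ : ℝ) : hybLower ε₁ ε₂ 0 = min ε₁ ε₂ := by
  rw [hybLower, hybRadius_of_coupling_zero, hybMean, hybHalfDiff]
  rcases le_total ε₁ ε₂ with h | h
  · rw [min_eq_left h, abs_of_nonpos (by linarith)]; ring
  · rw [min_eq_right h, abs_of_nonneg (by linarith)]; ring

/-- Trace identity `(m + R) + (m − R) = ε₁ + ε₂`. [cite: MontambauxJerome2016, §3] -/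
theorem hyb_trace (ε₁ ε₂ Δ : ℝ) : hybUpper ε₁ ε₂ Δ + hybLower ε₁ ε₂ Δ = ε₁ + ε₂ := by
  unfold hybUpper hybLower hybMean; ring

/-- Determinant identity `(m + R)(m − R) = ε₁ε₂ − Δ²`. [cite: MontambauxJerome2016, §3] -/
theorem hyb_det (ε₁ ε₂ Δ : ℝ) : hybUpper ε₁ ε₂ Δ * hybLower ε₁ ε₂ Δ = ε₁ * ε₂ - Δ ^ 2 := by
  have h := hybRadius_sq ε₁ ε₂ Δ
  unfold hybUpper hybLower hybMean
  unfold hybHalfDiff at h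
  nlinarith [h]

/-- The characteristic polynomial factorises over the two hybridised levels.
[cite: MontambauxJerome2016, §3] -/
theorem hyb_charpoly_factor (ε₁ ε₂ Δ x : ℝ) :
    (x - ε₁) * (x - ε₂) - Δ ^ 2 = (x - hybUpper ε₁ ε₂ Δ) * (x - hybLower ε₁ ε₂ Δ) := by
  have h := hybRadius_sq ε₁ ε₂ Δ
  unfold hybUpper hybLower hybMean
  unfold hybHalfDiff at h
  nlinarith [h]

/-- `x` is an eigenvalue (a root of the characteristic polynomial) iff `x = m + R` or
`x = m − R`. [cite: MontambauxJerome2016, §3] -/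
theorem hyb_charpoly_root_iff (ε₁ ε₂ Δ x : ℝ) :
    (x - ε₁) * (x - ε₂) - Δ ^ 2 = 0 ↔ x = hybUpper ε₁ ε₂ Δ ∨ x = hybLower ε₁ ε₂ Δ := by
  rw [hyb_charpoly_factor, mul_eq_zero, sub_eq_zero, sub_eq_zero]

/-- Eigenvector `(d + R, Δ)` of the upper level. [cite: MontambauxJerome2016, §3] -/
theorem hybBloch_mulVec_upper (ε₁ ε₂ Δ : ℝ) :
    (hybBloch ε₁ ε₂ Δ) *ᵥ ![hybHalfDiff ε₁ ε₂ + hybRadius ε₁ ε₂ Δ, Δ]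
      = hybUpper ε₁ ε₂ Δ • ![hybHalfDiff ε₁ ε₂ + hybRadius ε₁ ε₂ Δ, Δ] := by
  have h := hybRadius_sq ε₁ ε₂ Δ
  set R := hybRadius ε₁ ε₂ Δ with hR
  unfold hybUpper hybMean; unfold hybHalfDiff at h ⊢
  ext i; fin_cases i <;>
    simp [hybBloch, Matrix.mulVec, dotProduct, Fin.sum_univ_two, hR] <;> nlinarith [h]

/-- Eigenvector `(d − R, Δ)` of the lower level. [cite: MontambauxJerome2016, §3] -/
theorem hybBloch_mulVec_lower (ε₁ ε₂ Δ : ℝ) :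
    (hybBloch ε₁ ε₂ Δ) *ᵥ ![hybHalfDiff ε₁ ε₂ - hybRadius ε₁ ε₂ Δ, Δ]
      = hybLower ε₁ ε₂ Δ • ![hybHalfDiff ε₁ ε₂ - hybRadius ε₁ ε₂ Δ, Δ] := by
  have h := hybRadius_sq ε₁ ε₂ Δ
  set R := hybRadius ε₁ ε₂ Δ with hR
  unfold hybLower hybMean; unfold hybHalfDiff at h ⊢
  ext i; fin_cases i <;>
    simp [hybBloch, Matrix.mulVec, dotProduct, Fin.sum_univ_two, hR] <;> nlinarith [h]

/-- Eigenvector `(Δ, R − d)` of the upper level (the form that does not vanish when `Δ ≠ 0` or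
`d < R`). [cite: MontambauxJerome2016, §3] -/
theorem hybBloch_mulVec_upper' (ε₁ ε₂ Δ : ℝ) :
    (hybBloch ε₁ ε₂ Δ) *ᵥ ![Δ, hybRadius ε₁ ε₂ Δ - hybHalfDiff ε₁ ε₂]
      = hybUpper ε₁ ε₂ Δ • ![Δ, hybRadius ε₁ ε₂ Δ - hybHalfDiff ε₁ ε₂] := by
  have h := hybRadius_sq ε₁ ε₂ Δ
  set R := hybRadius ε₁ ε₂ Δ with hR
  unfold hybUpper hybMean; unfold hybHalfDiff at h ⊢
  ext i; fin_cases i <;>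
    simp [hybBloch, Matrix.mulVec, dotProduct, Fin.sum_univ_two, hR] <;> nlinarith [h]

/-- Eigenvector `(Δ, −(R + d))` of the lower level. [cite: MontambauxJerome2016, §3] -/
theorem hybBloch_mulVec_lower' (ε₁ ε₂ Δ : ℝ) :
    (hybBloch ε₁ ε₂ Δ) *ᵥ ![Δ, -(hybRadius ε₁ ε₂ Δ + hybHalfDiff ε₁ ε₂)]
      = hybLower ε₁ ε₂ Δ • ![Δ, -(hybRadius ε₁ ε₂ Δ + hybHalfDiff ε₁ ε₂)] := by
  have h := hybRadius_sq ε₁ ε₂ Δ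
  set R := hybRadius ε₁ ε₂ Δ with hR
  unfold hybLower hybMean; unfold hybHalfDiff at h ⊢
  ext i; fin_cases i <;>
    simp [hybBloch, Matrix.mulVec, dotProduct, Fin.sum_univ_two, hR] <;> nlinarith [h]

/-- For `Δ ≠ 0` the eigenvectors `(d ± R, Δ)` are nonzero. [cite: MontambauxJerome2016, §3] -/
theorem hyb_eigvec_ne_zero {Δ : ℝ} (hΔ : Δ ≠ 0) (a : ℝ) : (![a, Δ] : Fin 2 → ℝ) ≠ 0 := by
  intro h
  have := congrFun h 1
  simp at this
  exact hΔ this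

/-! ### 2. The anion-ordering instance -/

/-- The AO-folded Bloch matrix of the linearised quasi-1D band: bare levels
`ε_k = ξ − 2t_b cos(k_y b)` and `ε_{k−Q⊥} = ξ + 2t_b cos(k_y b)` (`ξ = ħv_F(k_x − k_F)`,
`t′_b = 0`), coupled by the anion potential `Δ`. [cite: MontambauxJerome2016, §3 Eq. for H_A(k)] -/
noncomputable def aoBloch (ξ tb Δ ky b : ℝ) : Matrix (Fin 2) (Fin 2) ℝ :=
  hybBloch (ξ - 2 * tb * cos (ky * b)) (ξ + 2 * tb * cos (ky * b)) Δ

/-- The AO radius `√(Δ² + 4t_b² cos²(k_y b))`. [cite: MontambauxJerome2016, §3 Eq. for E_k] -/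
noncomputable def aoRadius (tb Δ ky b : ℝ) : ℝ := Real.sqrt (Δ ^ 2 + 4 * tb ^ 2 * cos (ky * b) ^ 2)

/-- Upper folded band `E₊ = ξ + √(Δ² + 4t_b² cos²(k_y b))`. [cite: MontambauxJerome2016, §3] -/
noncomputable def aoUpper (ξ tb Δ ky b : ℝ) : ℝ := ξ + aoRadius tb Δ ky b

/-- Lower folded band `E₋ = ξ − √(Δ² + 4t_b² cos²(k_y b))`. [cite: MontambauxJerome2016, §3] -/
noncomputable def aoLower (ξ tb Δ ky b : ℝ) : ℝ := ξ - aoRadius tb Δ ky b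

/-- Unfolding of the AO Bloch matrix `!![ξ − 2t_b cos k_y b, Δ; Δ, ξ + 2t_b cos k_y b]`. [cite: MontambauxJerome2016, §3] -/
theorem aoBloch_def (ξ tb Δ ky b : ℝ) :
    aoBloch ξ tb Δ ky b = !![ξ - 2 * tb * cos (ky * b), Δ; Δ, ξ + 2 * tb * cos (ky * b)] := rfl
/-- Unfolding of the AO radius. [cite: MontambauxJerome2016, §3] -/
theorem aoRadius_def (tb Δ ky b : ℝ) :
    aoRadius tb Δ ky b = Real.sqrt (Δ ^ 2 + 4 * tb ^ 2 * cos (ky * b) ^ 2) := rfl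
/-- Unfolding of `E₊ = ξ + √(Δ² + 4t_b² cos² k_y b)`. [cite: MontambauxJerome2016, §3] -/
theorem aoUpper_def (ξ tb Δ ky b : ℝ) :
    aoUpper ξ tb Δ ky b = ξ + Real.sqrt (Δ ^ 2 + 4 * tb ^ 2 * cos (ky * b) ^ 2) := rfl
/-- Unfolding of `E₋ = ξ − √(Δ² + 4t_b² cos² k_y b)`. [cite: MontambauxJerome2016, §3] -/
theorem aoLower_def (ξ tb Δ ky b : ℝ) :
    aoLower ξ tb Δ ky b = ξ - Real.sqrt (Δ ^ 2 + 4 * tb ^ 2 * cos (ky * b) ^ 2) := rfl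

/-- `0 ≤ √(Δ² + 4t_b² cos² k_y b)`. [cite: MontambauxJerome2016, §3] -/
theorem aoRadius_nonneg (tb Δ ky b : ℝ) : 0 ≤ aoRadius tb Δ ky b := Real.sqrt_nonneg _

/-- Square of the AO radius. [cite: MontambauxJerome2016, §3] -/
theorem aoRadius_sq (tb Δ ky b : ℝ) :
    aoRadius tb Δ ky b ^ 2 = Δ ^ 2 + 4 * tb ^ 2 * cos (ky * b) ^ 2 :=
  Real.sq_sqrt (by positivity)

/-- The AO instance of the two-level data: `m = ξ`, `d = −2t_b cos(k_y b)`, `R = aoRadius`.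
[cite: MontambauxJerome2016, §3] -/
theorem ao_hybMean (ξ tb ky b : ℝ) :
    hybMean (ξ - 2 * tb * cos (ky * b)) (ξ + 2 * tb * cos (ky * b)) = ξ := by
  unfold hybMean; ring

/-- Half-difference of the two AO bare levels is `−2t_b cos k_y b`. [cite: MontambauxJerome2016, §3] -/
theorem ao_hybHalfDiff (ξ tb ky b : ℝ) :
    hybHalfDiff (ξ - 2 * tb * cos (ky * b)) (ξ + 2 * tb * cos (ky * b)) = -(2 * tb * cos (ky * b)) := by
  unfold hybHalfDiff; ring

/-- The two-level radius of the AO bare levels is the AO radius. [cite: MontambauxJerome2016, §3] -/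
theorem ao_hybRadius (ξ tb Δ ky b : ℝ) :
    hybRadius (ξ - 2 * tb * cos (ky * b)) (ξ + 2 * tb * cos (ky * b)) Δ = aoRadius tb Δ ky b := by
  rw [hybRadius, ao_hybHalfDiff, aoRadius]; congr 1; ring

/-- `E₊` is the upper hybridised level of the AO Bloch matrix. [cite: MontambauxJerome2016, §3] -/
theorem ao_band_upper (ξ tb Δ ky b : ℝ) :
    hybUpper (ξ - 2 * tb * cos (ky * b)) (ξ + 2 * tb * cos (ky * b)) Δ = aoUpper ξ tb Δ ky b := by
  rw [hybUpper, ao_hybMean, ao_hybRadius, aoUpper]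

/-- `E₋` is the lower hybridised level of the AO Bloch matrix. [cite: MontambauxJerome2016, §3] -/
theorem ao_band_lower (ξ tb Δ ky b : ℝ) :
    hybLower (ξ - 2 * tb * cos (ky * b)) (ξ + 2 * tb * cos (ky * b)) Δ = aoLower ξ tb Δ ky b := by
  rw [hybLower, ao_hybMean, ao_hybRadius, aoLower]

/-- Eigen-equation of the upper folded band, eigenvector `(Δ, R + 2t_b cos k_y b)`.
[cite: MontambauxJerome2016, §3 Eq. for E_k] -/
theorem aoBloch_mulVec_upper (ξ tb Δ ky b : ℝ) :
    (aoBloch ξ tb Δ ky b) *ᵥ ![Δ, aoRadius tb Δ ky b + 2 * tb * cos (ky * b)]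
      = aoUpper ξ tb Δ ky b • ![Δ, aoRadius tb Δ ky b + 2 * tb * cos (ky * b)] := by
  have h := hybBloch_mulVec_upper' (ξ - 2 * tb * cos (ky * b)) (ξ + 2 * tb * cos (ky * b)) Δ
  rw [ao_hybRadius, ao_hybHalfDiff, ao_band_upper, sub_neg_eq_add] at h
  exact h

/-- Eigen-equation of the lower folded band, eigenvector `(Δ, −(R − 2t_b cos k_y b))`.
[cite: MontambauxJerome2016, §3 Eq. for E_k] -/
theorem aoBloch_mulVec_lower (ξ tb Δ ky b : ℝ) :
    (aoBloch ξ tb Δ ky b) *ᵥ ![Δ, -(aoRadius tb Δ ky b - 2 * tb * cos (ky * b))]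
      = aoLower ξ tb Δ ky b • ![Δ, -(aoRadius tb Δ ky b - 2 * tb * cos (ky * b))] := by
  have h := hybBloch_mulVec_lower' (ξ - 2 * tb * cos (ky * b)) (ξ + 2 * tb * cos (ky * b)) Δ
  rw [ao_hybRadius, ao_hybHalfDiff, ao_band_lower, ← sub_eq_add_neg] at h
  exact h

/-- The AO splitting `E₊ − E₋ = 2√(Δ² + 4t_b² cos² k_y b)`. [cite: MontambauxJerome2016, §3] -/
theorem ao_splitting (ξ tb Δ ky b : ℝ) :
    aoUpper ξ tb Δ ky b - aoLower ξ tb Δ ky b = 2 * aoRadius tb Δ ky b := by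
  unfold aoUpper aoLower; ring

/-- The AO gap between the two folded bands is at least `2|Δ|` everywhere.
[cite: MontambauxJerome2016, §3 ("the gap being 2Δ⊥")] -/
theorem ao_splitting_ge (ξ tb Δ ky b : ℝ) :
    2 * |Δ| ≤ aoUpper ξ tb Δ ky b - aoLower ξ tb Δ ky b := by
  rw [← ao_band_upper, ← ao_band_lower]; exact hyb_splitting_ge _ _ _

/-- At the folded-zone boundary `k_y b = π/2` the splitting is exactly `2|Δ|`.
[cite: MontambauxJerome2016, §3 (magnetic breakdown near (k_F, ±π/2b))] -/
theorem ao_splitting_zone_boundary (ξ tb Δ ky b : ℝ) (h : ky * b = π / 2) :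
    aoUpper ξ tb Δ ky b - aoLower ξ tb Δ ky b = 2 * |Δ| := by
  rw [ao_splitting, aoRadius, h, Real.cos_pi_div_two]
  simp [Real.sqrt_sq_eq_abs]

/-- The splitting is at most `2√(Δ² + 4t_b²)` (value at `k_y = 0`). [cite: MontambauxJerome2016, §3] -/
theorem ao_splitting_le (ξ tb Δ ky b : ℝ) :
    aoUpper ξ tb Δ ky b - aoLower ξ tb Δ ky b ≤ 2 * Real.sqrt (Δ ^ 2 + 4 * tb ^ 2) := by
  rw [ao_splitting, aoRadius]
  have hc : cos (ky * b) ^ 2 ≤ 1 := by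
    rw [sq_le_one_iff_abs_le_one]; exact Real.abs_cos_le_one _
  have : Δ ^ 2 + 4 * tb ^ 2 * cos (ky * b) ^ 2 ≤ Δ ^ 2 + 4 * tb ^ 2 := by nlinarith [sq_nonneg tb]
  linarith [Real.sqrt_le_sqrt this]

/-- At `k_y = 0` the splitting is the maximal `2√(Δ² + 4t_b²)`. [cite: MontambauxJerome2016, §3] -/
theorem ao_splitting_zero_ky (ξ tb Δ b : ℝ) :
    aoUpper ξ tb Δ 0 b - aoLower ξ tb Δ 0 b = 2 * Real.sqrt (Δ ^ 2 + 4 * tb ^ 2) := by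
  rw [ao_splitting, aoRadius, zero_mul, Real.cos_zero]; ring_nf

/-- QUENCHED twin (`Δ = 0`): the upper band is the bare `ξ + 2|t_b cos k_y b|`.
[cite: MontambauxJerome2016, §3] -/
theorem ao_band_upper_quenched (ξ tb ky b : ℝ) :
    aoUpper ξ tb 0 ky b = ξ + 2 * |tb * cos (ky * b)| := by
  rw [aoUpper, aoRadius]
  have : (0:ℝ) ^ 2 + 4 * tb ^ 2 * cos (ky * b) ^ 2 = (2 * (tb * cos (ky * b))) ^ 2 := by ring
  rw [this, Real.sqrt_sq_eq_abs, abs_mul, abs_two]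

/-- QUENCHED twin (`Δ = 0`): the lower band is the bare `ξ − 2|t_b cos k_y b|`. [cite: MontambauxJerome2016, §3] -/
theorem ao_band_lower_quenched (ξ tb ky b : ℝ) :
    aoLower ξ tb 0 ky b = ξ - 2 * |tb * cos (ky * b)| := by
  rw [aoLower, aoRadius]
  have : (0:ℝ) ^ 2 + 4 * tb ^ 2 * cos (ky * b) ^ 2 = (2 * (tb * cos (ky * b))) ^ 2 := by ring
  rw [this, Real.sqrt_sq_eq_abs, abs_mul, abs_two]

/-- QUENCHED twin: the two bare sheets cross (zero splitting) at `k_y b = π/2`.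
[cite: MontambauxJerome2016, §3] -/
theorem ao_splitting_quenched_zone_boundary (ξ tb ky b : ℝ) (h : ky * b = π / 2) :
    aoUpper ξ tb 0 ky b - aoLower ξ tb 0 ky b = 0 := by
  rw [ao_splitting_zone_boundary ξ tb 0 ky b h, abs_zero, mul_zero]

/-- The splitting vanishes somewhere iff `Δ = 0` and `cos(k_y b) = 0` or `t_b = 0`.
[cite: MontambauxJerome2016, §3] -/
theorem ao_splitting_eq_zero_iff (ξ tb Δ ky b : ℝ) :
    aoUpper ξ tb Δ ky b - aoLower ξ tb Δ ky b = 0 ↔ Δ = 0 ∧ tb * cos (ky * b) = 0 := by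
  rw [ao_splitting, mul_eq_zero, aoRadius, Real.sqrt_eq_zero (by positivity)]
  constructor
  · rintro (h | h)
    · norm_num at h
    · have h1 : Δ ^ 2 = 0 := by nlinarith [sq_nonneg Δ, sq_nonneg (tb * cos (ky * b))]
      have h2 : (tb * cos (ky * b)) ^ 2 = 0 := by nlinarith [sq_nonneg Δ, sq_nonneg (tb * cos (ky * b))]
      exact ⟨pow_eq_zero_iff (n := 2) (by norm_num) |>.mp h1, pow_eq_zero_iff (n := 2) (by norm_num) |>.mp h2⟩
  · rintro ⟨h1, h2⟩
    right; rw [h1]; nlinarith [h2]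

/-- Fermi surface of the upper folded band: `E₊ = 0 ⇔ ξ = −√(…)`, i.e. with `ξ = ħv_F(k_x − k_F)`,
`k_x = k_F − √(…)/ħv_F`. [cite: MontambauxJerome2016, §3 Eq. for k_x] -/
theorem ao_fermi_upper_iff (hvF kx kF tb Δ ky b : ℝ) (hv : hvF ≠ 0) :
    aoUpper (hvF * (kx - kF)) tb Δ ky b = 0 ↔ kx = kF - aoRadius tb Δ ky b / hvF := by
  rw [aoUpper]
  constructor
  · intro h; field_simp; linarith [h]
  · intro h; rw [h]; field_simp; ring

/-- Fermi surface of the lower folded band: `k_x = k_F + √(…)/ħv_F`.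
[cite: MontambauxJerome2016, §3 Eq. for k_x] -/
theorem ao_fermi_lower_iff (hvF kx kF tb Δ ky b : ℝ) (hv : hvF ≠ 0) :
    aoLower (hvF * (kx - kF)) tb Δ ky b = 0 ↔ kx = kF + aoRadius tb Δ ky b / hvF := by
  rw [aoLower]
  constructor
  · intro h; field_simp; linarith [h]
  · intro h; rw [h]; field_simp; ring

/-- The two same-side sheets are `2√(…)/ħv_F` apart in `k_x`, at least `2|Δ|/ħv_F` for
`ħv_F > 0` (they never touch in the relaxed twin with `Δ ≠ 0`). [cite: MontambauxJerome2016, §3] -/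
theorem ao_sheetSeparation_ge (hvF kF tb Δ ky b : ℝ) (hv : 0 < hvF) :
    2 * |Δ| / hvF ≤ (kF + aoRadius tb Δ ky b / hvF) - (kF - aoRadius tb Δ ky b / hvF) := by
  have h1 : (kF + aoRadius tb Δ ky b / hvF) - (kF - aoRadius tb Δ ky b / hvF)
      = 2 * aoRadius tb Δ ky b / hvF := by ring
  rw [h1]
  have h2 : |Δ| ≤ aoRadius tb Δ ky b := by
    rw [aoRadius, ← Real.sqrt_sq_eq_abs]
    exact Real.sqrt_le_sqrt (by nlinarith [sq_nonneg (tb * cos (ky * b))])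
  exact div_le_div_of_nonneg_right (by linarith) hv.le

/-! ### 3. Magnetic breakdown field, Landau–Zener probability, rapid-oscillation field -/

/-- The magnetic-breakdown field `B⊥ = (π/2)·Δ²/(e t_b b v_F)`.
[cite: MontambauxJerome2016, §3 Eq. for B⊥] -/
noncomputable def aoBreakdownField (Δ e tb b vF : ℝ) : ℝ := (π / 2) * Δ ^ 2 / (e * tb * b * vF)

/-- Unfolding of `B⊥`. [cite: MontambauxJerome2016, §3] -/
theorem aoBreakdownField_def (Δ e tb b vF : ℝ) :
    aoBreakdownField Δ e tb b vF = (π / 2) * Δ ^ 2 / (e * tb * b * vF) := rfl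

/-- Quenched twin: `B⊥ = 0`. [cite: MontambauxJerome2016, §3] -/
theorem aoBreakdownField_zero (e tb b vF : ℝ) : aoBreakdownField 0 e tb b vF = 0 := by
  simp [aoBreakdownField]

/-- `B⊥` is quadratic in the AO amplitude. [cite: MontambauxJerome2016, §3] -/
theorem aoBreakdownField_smul (c Δ e tb b vF : ℝ) :
    aoBreakdownField (c * Δ) e tb b vF = c ^ 2 * aoBreakdownField Δ e tb b vF := by
  unfold aoBreakdownField; ring

/-- `0 ≤ B⊥` for a non-negative denominator. [cite: MontambauxJerome2016, §3] -/
theorem aoBreakdownField_nonneg {Δ e tb b vF : ℝ} (h : 0 ≤ e * tb * b * vF) :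
    0 ≤ aoBreakdownField Δ e tb b vF := by
  unfold aoBreakdownField; positivity

/-- `B⊥` is monotone in `|Δ|` (positive denominators). [cite: MontambauxJerome2016, §3] -/
theorem aoBreakdownField_mono {Δ₁ Δ₂ e tb b vF : ℝ} (h : 0 < e * tb * b * vF)
    (hΔ : |Δ₁| ≤ |Δ₂|) : aoBreakdownField Δ₁ e tb b vF ≤ aoBreakdownField Δ₂ e tb b vF := by
  unfold aoBreakdownField
  apply div_le_div_of_nonneg_right _ h.le
  have : Δ₁ ^ 2 ≤ Δ₂ ^ 2 := by
    rw [← sq_abs Δ₁, ← sq_abs Δ₂]; exact pow_le_pow_left₀ (abs_nonneg _) hΔ 2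
  have hπ : 0 < π / 2 := by positivity
  nlinarith

/-- Landau–Zener (magnetic breakdown) probability `p⊥ = exp(−B⊥/B)`.
[cite: MontambauxJerome2016, §3 Eq. for p⊥] -/
noncomputable def lzProbability (Bperp B : ℝ) : ℝ := Real.exp (-(Bperp / B))

/-- Unfolding of `p⊥ = exp(−B⊥/B)`. [cite: MontambauxJerome2016, §3] -/
theorem lzProbability_def (Bperp B : ℝ) : lzProbability Bperp B = Real.exp (-(Bperp / B)) := rfl

/-- `0 < p⊥`. [cite: MontambauxJerome2016, §3] -/
theorem lzProbability_pos (Bperp B : ℝ) : 0 < lzProbability Bperp B := Real.exp_pos _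

/-- `p⊥ ≤ 1` for `B⊥, B ≥ 0`. [cite: MontambauxJerome2016, §3] -/
theorem lzProbability_le_one {Bperp B : ℝ} (hB : 0 ≤ Bperp) (hB' : 0 ≤ B) :
    lzProbability Bperp B ≤ 1 := by
  rw [lzProbability, Real.exp_le_one_iff, neg_nonpos]; positivity

/-- Full breakdown (`p⊥ = 1`) iff `B⊥ = 0` (for `B ≠ 0`): the quenched twin.
[cite: MontambauxJerome2016, §3] -/
theorem lzProbability_eq_one_iff {Bperp B : ℝ} (hB : B ≠ 0) :
    lzProbability Bperp B = 1 ↔ Bperp = 0 := by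
  rw [lzProbability, Real.exp_eq_one_iff, neg_eq_zero, div_eq_zero_iff, or_iff_left hB]

/-- `p⊥` decreases with `B⊥` at fixed `B > 0`. [cite: MontambauxJerome2016, §3] -/
theorem lzProbability_antitone {B : ℝ} (hB : 0 < B) {x y : ℝ} (hxy : x ≤ y) :
    lzProbability y B ≤ lzProbability x B := by
  unfold lzProbability
  exact Real.exp_le_exp.mpr (by
    have := div_le_div_of_nonneg_right hxy hB.le
    linarith)

/-- `p⊥ = 1/2` exactly at the field `B_m = B⊥ / log 2`. [cite: MontambauxJerome2016, §3] -/
theorem lzProbability_eq_half_iff {Bperp B : ℝ} (hB : B ≠ 0) :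
    lzProbability Bperp B = 1 / 2 ↔ B = Bperp / Real.log 2 := by
  have hlog : Real.log 2 ≠ 0 := by positivity
  rw [lzProbability]
  constructor
  · intro h
    have h1 : -(Bperp / B) = Real.log (1 / 2) := by rw [← h, Real.log_exp]
    rw [one_div, Real.log_inv] at h1
    have h2 : Bperp / B = Real.log 2 := by linarith
    field_simp at h2
    field_simp
    linarith
  · intro h
    rw [h]
    have : -(Bperp / (Bperp / Real.log 2)) = -Real.log 2 := by
      have hBp : Bperp ≠ 0 := by
        rintro rfl; simp at h; exact hB h
      field_simp
    rw [this, Real.exp_neg, Real.exp_log (by norm_num)]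
    norm_num

/-- The Stark interference amplitude factor `2p(1 − p)`. [cite: MontambauxJerome2016, §3 Eq. for σ_osc] -/
noncomputable def starkFactor (p : ℝ) : ℝ := 2 * p * (1 - p)

/-- Unfolding of `2p(1 − p)`. [cite: MontambauxJerome2016, §3] -/
theorem starkFactor_def (p : ℝ) : starkFactor p = 2 * p * (1 - p) := rfl

/-- `2p(1 − p) ≤ 1/2`, with equality iff `p = 1/2` ("maximal for p⊥ = 1/2").
[cite: MontambauxJerome2016, §3] -/
theorem starkFactor_le_half (p : ℝ) : starkFactor p ≤ 1 / 2 := by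
  unfold starkFactor; nlinarith [sq_nonneg (p - 1 / 2)]

/-- `2p(1 − p) = 1/2` iff `p = 1/2` (their `B_m = B⊥/ln 2`). [cite: MontambauxJerome2016, §3] -/
theorem starkFactor_eq_half_iff (p : ℝ) : starkFactor p = 1 / 2 ↔ p = 1 / 2 := by
  unfold starkFactor
  constructor
  · intro h
    have : (p - 1 / 2) ^ 2 = 0 := by nlinarith
    have := pow_eq_zero_iff (n := 2) (by norm_num) |>.mp this
    linarith
  · rintro rfl; norm_num

/-- The oscillations vanish without breakdown (`p = 0`) and with full breakdown (`p = 1`).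
[cite: MontambauxJerome2016, §3] -/
theorem starkFactor_zero : starkFactor 0 = 0 := by simp [starkFactor]
/-- Full breakdown (`p = 1`): no interference oscillations. [cite: MontambauxJerome2016, §3] -/
theorem starkFactor_one : starkFactor 1 = 0 := by simp [starkFactor]

/-- `F⊥(x) = ∫₀^{π/2} √(cos² t + x²) dt`. [cite: MontambauxJerome2016, §3 Eq. for F⊥] -/
noncomputable def fPerp (x : ℝ) : ℝ := ∫ t in (0:ℝ)..(π / 2), Real.sqrt (cos t ^ 2 + x ^ 2)

/-- Unfolding of `F⊥`. [cite: MontambauxJerome2016, §3] -/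
theorem fPerp_def (x : ℝ) : fPerp x = ∫ t in (0:ℝ)..(π / 2), Real.sqrt (cos t ^ 2 + x ^ 2) := rfl

/-- The integrand `√(cos² t + x²)` is continuous. [cite: MontambauxJerome2016, §3] -/
private theorem continuous_fPerp_integrand (x : ℝ) :
    Continuous fun t : ℝ => Real.sqrt (cos t ^ 2 + x ^ 2) := by
  fun_prop

/-- `F⊥(0) = 1` (so `B*(0) = 4t_b/(π e v_F b)`, the `ϕ(0)` normalisation).
[cite: MontambauxJerome2016, §3] -/
theorem fPerp_zero : fPerp 0 = 1 := by
  rw [fPerp]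
  have h : ∫ t in (0:ℝ)..(π / 2), Real.sqrt (cos t ^ 2 + (0:ℝ) ^ 2) = ∫ t in (0:ℝ)..(π / 2), cos t := by
    apply intervalIntegral.integral_congr
    intro t ht
    rw [Set.uIcc_of_le (by positivity)] at ht
    have hc : 0 ≤ cos t := Real.cos_nonneg_of_mem_Icc ⟨by linarith [ht.1, Real.pi_pos], ht.2⟩
    simp only
    rw [sq (0:ℝ), zero_mul, add_zero, Real.sqrt_sq hc]
  rw [h, integral_cos, Real.sin_pi_div_two, Real.sin_zero, sub_zero]

/-- `F⊥` is even. [cite: MontambauxJerome2016, §3] -/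
theorem fPerp_even (x : ℝ) : fPerp (-x) = fPerp x := by
  simp [fPerp]

/-- `F⊥` is monotone in `|x|`: the interfering orbits move apart as the gap grows.
[cite: MontambauxJerome2016, §3 ("It increases with Δ⊥")] -/
theorem fPerp_mono {x y : ℝ} (hxy : |x| ≤ |y|) : fPerp x ≤ fPerp y := by
  unfold fPerp
  apply intervalIntegral.integral_mono_on (by positivity)
    ((continuous_fPerp_integrand x).intervalIntegrable _ _)
    ((continuous_fPerp_integrand y).intervalIntegrable _ _)
  intro t _
  apply Real.sqrt_le_sqrt
  have : x ^ 2 ≤ y ^ 2 := by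
    rw [← sq_abs x, ← sq_abs y]; exact pow_le_pow_left₀ (abs_nonneg _) hxy 2
  linarith

/-- `1 = F⊥(0) ≤ F⊥(x)`. [cite: MontambauxJerome2016, §3] -/
theorem one_le_fPerp (x : ℝ) : 1 ≤ fPerp x := by
  rw [← fPerp_zero]; exact fPerp_mono (by simp)

/-- `(π/2)|x| ≤ F⊥(x) ≤ (π/2)√(1 + x²)`. [cite: MontambauxJerome2016, §3] -/
theorem fPerp_bounds (x : ℝ) :
    (π / 2) * |x| ≤ fPerp x ∧ fPerp x ≤ (π / 2) * Real.sqrt (1 + x ^ 2) := by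
  have hπ : (0:ℝ) ≤ π / 2 := by positivity
  constructor
  · have h : ∫ _ in (0:ℝ)..(π / 2), |x| ≤ fPerp x := by
      unfold fPerp
      apply intervalIntegral.integral_mono_on hπ intervalIntegrable_const
        ((continuous_fPerp_integrand x).intervalIntegrable _ _)
      intro t _
      rw [← Real.sqrt_sq_eq_abs]
      exact Real.sqrt_le_sqrt (by nlinarith [sq_nonneg (cos t)])
    rw [intervalIntegral.integral_const, smul_eq_mul, sub_zero] at h
    exact h
  · have h : fPerp x ≤ ∫ _ in (0:ℝ)..(π / 2), Real.sqrt (1 + x ^ 2) := by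
      unfold fPerp
      apply intervalIntegral.integral_mono_on hπ
        ((continuous_fPerp_integrand x).intervalIntegrable _ _) intervalIntegrable_const
      intro t _
      apply Real.sqrt_le_sqrt
      have hc : cos t ^ 2 ≤ 1 := by
        rw [sq_le_one_iff_abs_le_one]; exact Real.abs_cos_le_one _
      linarith
    rw [intervalIntegral.integral_const, smul_eq_mul, sub_zero] at h
    exact h

/-- The rapid-oscillation characteristic field
`B*(Δ) = (4t_b/(π e v_F b))·F⊥(Δ/2t_b)`. [cite: MontambauxJerome2016, §3 Eq. for B*(Δ⊥)] -/
noncomputable def roField (tb e vF b Δ : ℝ) : ℝ := 4 * tb / (π * e * vF * b) * fPerp (Δ / (2 * tb))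

/-- Unfolding of `B*(Δ)`. [cite: MontambauxJerome2016, §3] -/
theorem roField_def (tb e vF b Δ : ℝ) :
    roField tb e vF b Δ = 4 * tb / (π * e * vF * b) * fPerp (Δ / (2 * tb)) := rfl

/-- Without anion gap, `B*(0) = 4t_b/(π e v_F b)` (`ϕ(0) = 8t_b/(e v_F b B)`).
[cite: MontambauxJerome2016, §3] -/
theorem roField_zero (tb e vF b : ℝ) : roField tb e vF b 0 = 4 * tb / (π * e * vF * b) := by
  rw [roField, zero_div, fPerp_zero, mul_one]

/-- `B*` increases with `|Δ|` (positive prefactor). [cite: MontambauxJerome2016, §3] -/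
theorem roField_mono {tb e vF b Δ₁ Δ₂ : ℝ} (hpre : 0 ≤ 4 * tb / (π * e * vF * b))
    (hΔ : |Δ₁| ≤ |Δ₂|) : roField tb e vF b Δ₁ ≤ roField tb e vF b Δ₂ := by
  unfold roField
  apply mul_le_mul_of_nonneg_left _ hpre
  apply fPerp_mono
  rw [abs_div, abs_div]
  rcases eq_or_ne (2 * tb) 0 with h | h
  · simp [h]
  · exact div_le_div_of_nonneg_right hΔ (abs_nonneg _)

/-- `B*(Δ) ≥ B*(0)`: the anion gap can only raise the rapid-oscillation frequency.
[cite: MontambauxJerome2016, §3] -/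
theorem roField_zero_le {tb e vF b : ℝ} (hpre : 0 ≤ 4 * tb / (π * e * vF * b)) (Δ : ℝ) :
    roField tb e vF b 0 ≤ roField tb e vF b Δ :=
  roField_mono hpre (by simp)

end Literature.MathematicalPhysics.QuantumLattice
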